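import Summits.BirchSwinnertonDyer.BirchSwinnertonDyer.Theses.CongruentShaFreeCut
import Summits.BirchSwinnertonDyer.BirchSwinnertonDyer.Theorems.CongruentShaFreeCutRungSupersingular
import Summits.BirchSwinnertonDyer.Rank1Residual.Partition.MainConjecturesCMAnyOrder
import Literature.NumberTheory.EllipticCurves.BSDSelmerCMPConverse
import Literature.NumberTheory.EllipticCurves.BSDSelmerCMPConverseRankOneProofs
import Literature.NumberTheory.EllipticCurves.BSDWave0TunnellProofs
import Literature.NumberTheory.EllipticCurves.BSDAnalyticRankTunnellCMProofs
import Literature.NumberTheory.EllipticCurves.LiLiuTian2024.CongruentNumberFullBSD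

/-! # Route `CongruentShaFreeCut` (rung S2) — the Ш-finite converse for `E_n` holds at EVERY prime
`p ≥ 5` of good reduction (modulo two refereed facts): the crux `AnalyticRankOneOfRankOneFiniteShaTwo`
(stmt-BirchSwinnertonDyer-19080) is the same statement at the ADDITIVE prime `2`

The ladder placement of crux B, kernel-checked. For square-free `n` and a prime `p ≥ 5` with `p ∤ n`
(so `p ∤ 2n`: good reduction of `E_n : y² = x³ − n²x`), `rank E_n(ℚ) = 1 ∧ #Ш(E_n/ℚ)[p^∞] < ∞ ⟹
ord_{s=1} L(E_n, s) = 1`: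
* `p ≡ 3 (mod 4)` (inert in `ℚ(i)`, `a_p = 0`, SUPERSINGULAR): the landed BC5 rung
  `CongruentShaFreeCutRungSupersingular.stub_rung_supersingular` (p410927), modulo BKO, JIMJ 23 (2024)
  Thm. 1.5 (`hBKO`);
* `p ≡ 1 (mod 4)` (split in `ℚ(i)`, ORDINARY): Burungale–Tian, Invent. Math. 220 (2020) Thm. 1.2
  (`hBT`, tree fact `burungaleTian_analyticRank_eq_one_of_selmerCorank_eq_one_of_hasCM`: CM, good
  ordinary `p > 3`, `corank_{ℤ_p} Sel_{p^∞} = 1 ⟹ ord = 1`), with `corank = 1` from `rank = 1 ∧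
  #Ш[p^∞] < ∞` (Greenberg, `selmerCorank_eq_one_of_mordellWeilRank_eq_one_of_finite`) and
  ordinarity `p ∤ a_p(E_n)` from Deuring's «split ⟹ ordinary» as the tree THEOREM
  `Summit.BirchSwinnertonDyer.Rank1Residual.not_dvd_frobeniusTrace_of_maximal_of_cmSplit` (`j = 1728`,
  `d_K = −4` a square mod `p ≡ 1 (4)`: Mathlib `ZMod.exists_sq_eq_neg_one_iff`).
So, modulo `hBT` and `hBKO`, the rank-one Ш-finite `p`-converse for the congruent number family is a
tree theorem at every prime `p ≥ 5`, `p ∤ n` — i.e. at every good prime except `3` — and the primes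
left are `p = 3 ∤ n` (good supersingular, below BKO's `p ≥ 5`; Burungale–Skinner App. A, preprint)
and the ADDITIVE primes `p ∣ 2n`, among which `p = 2` for EVERY `n`: crux B. Numbers, not adjectives:
the crux is the `p = 2` column of a table whose `p ≥ 5, p ∤ n` columns are all filled by print.
Supports, does not close, stmt-BirchSwinnertonDyer-19080. -/

namespace Summit.BirchSwinnertonDyer.BirchSwinnertonDyer.Theorems.CongruentShaFreeCutGoodPrimes

open Literature.NumberTheory.EllipticCurves WeierstrassCurve
open Summit.BirchSwinnertonDyer.BirchSwinnertonDyer.Theses.CongruentShaFreeCut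

/-- **`p ≡ 1 (mod 4)` splits in `ℚ(i)`, the CM field of `E_n`** (`j(E_n) = 1728`,
`d_K = cmFieldDiscrOfJ 1728 = −4`; `−4 = (2i)²` with `i² = −1` in `𝔽_p`, Mathlib
`ZMod.exists_sq_eq_neg_one_iff`). [folklore] -/
theorem cmSplit_congruentNumberCurve {n : ℕ} (hn : n ≠ 0) {p : ℕ} [Fact p.Prime] (hp : 5 ≤ p)
    (hp4 : p % 4 = 1) :
    haveI := isElliptic_congruentNumberCurve hn
    Rank1Residual.CMSplit (congruentNumberCurve n) p := by
  haveI := isElliptic_congruentNumberCurve hn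
  have hj : Rank1Residual.cmFieldDiscrOfJ (congruentNumberCurve n).j = -4 := by
    rw [congruentNumberCurve_j]; norm_num [Rank1Residual.cmFieldDiscrOfJ]
  refine ⟨?_, ?_⟩
  · rw [hj]
    intro h
    have h4 : (p : ℤ) ∣ 4 := (dvd_neg.mp h)
    have : p ≤ 4 := Nat.le_of_dvd (by norm_num) (by exact_mod_cast h4)
    omega
  · rw [if_neg (by omega : p ≠ 2), hj]
    obtain ⟨x, hx⟩ := ZMod.exists_sq_eq_neg_one_iff.mpr (by omega : p % 4 ≠ 3)
    refine ⟨2 * x, ?_⟩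
    push_cast
    linear_combination (4 : ZMod p) * hx

/-- **The ORDINARY columns: `p ≡ 1 (mod 4)`, `p ≥ 5`, `p ∤ n`** (square-free `n`). Granted
Burungale–Tian 2020 Thm. 1.2 (`hBT`): `rank E_n(ℚ) = 1 ∧ #Ш(E_n/ℚ)[p^∞] < ∞ ⟹ ord_{s=1} L(E_n,s)
= 1`. Good reduction: `hasGoodReductionAtPrime_congruentNumberCurve` (`p ∤ 2n`); ordinarity:
Deuring (`not_dvd_frobeniusTrace_of_maximal_of_cmSplit`, `cmSplit_congruentNumberCurve`); corank
one: Greenberg (`selmerCorank_eq_one_of_mordellWeilRank_eq_one_of_finite`); CM: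
`LiLiuTian2024.hasCM_congruentNumberCurve`. [cite: BurungaleTian2019, Thm. 1.2 (p. 214)] -/
theorem analyticRank_eq_one_of_rank_eq_one_of_finite_sha_primary_ordinary
    (hBT : burungaleTian_analyticRank_eq_one_of_selmerCorank_eq_one_of_hasCM)
    {n : ℕ} (hn : Squarefree n) {p : ℕ} [Fact p.Prime] (hp : 5 ≤ p) (hp4 : p % 4 = 1)
    (hpn : ¬ p ∣ n) (hrank : (congruentNumberCurve n).mordellWeilRank = 1)
    (hsha : Finite (AddCommGroup.primaryComponent (congruentNumberCurve n).sha p)) :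
    (congruentNumberCurve n).analyticRank = 1 := by
  have hpP : p.Prime := Fact.out
  haveI := isElliptic_congruentNumberCurve hn.ne_zero
  haveI := isGloballyMinimal_congruentNumberCurve hn
  have hp2n : ¬ p ∣ 2 * n := by
    intro h
    rcases hpP.dvd_mul.1 h with h2 | h2
    · have := Nat.le_of_dvd two_pos h2
      omega
    · exact hpn h2
  have hgood : (congruentNumberCurve n).HasGoodReductionAtPrime p :=
    hasGoodReductionAtPrime_congruentNumberCurve hp2n
  have hord : ¬ (p : ℤ) ∣ (congruentNumberCurve n).frobeniusTrace p :=
    Rank1Residual.not_dvd_frobeniusTrace_of_maximal_of_cmSplit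
      (congruentNumberCurve_j_mem_maximalCMJInvariants n) (by omega) hgood
      (cmSplit_congruentNumberCurve hn.ne_zero hp hp4)
  exact hBT _ (LiLiuTian2024.hasCM_congruentNumberCurve n) p hp hgood hord
    (selmerCorank_eq_one_of_mordellWeilRank_eq_one_of_finite _ p hrank hsha)

/-- **The Ш-finite `p`-converse for `E_n` at every prime `p ≥ 5`, `p ∤ n`** (square-free `n`),
modulo Burungale–Tian 2020 Thm. 1.2 (`hBT`, ordinary `p ≡ 1 (4)`) and BKO 2024 Thm. 1.5 (`hBKO`,
supersingular `p ≡ 3 (4)`, through the landed rung `stub_rung_supersingular`):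
`rank E_n(ℚ) = 1 ∧ #Ш(E_n/ℚ)[p^∞] < ∞ ⟹ ord_{s=1} L(E_n, s) = 1`. Crux B is this statement at
`p = 2`, where `E_n` is additive; `p = 3 ∤ n` and `p ∣ n` are the other open columns.
[cite: BurungaleTian2019, Thm. 1.2 (p. 214)]
[cite: BurungaleKobayashiOta2023, Thm. 1.5 (JIMJ 23 (2024), p. 1422)] -/
theorem analyticRank_eq_one_of_rank_eq_one_of_finite_sha_primary_of_five_le
    (hBT : burungaleTian_analyticRank_eq_one_of_selmerCorank_eq_one_of_hasCM)
    (hBKO : BurungaleKobayashiOta2024.thm15_analyticRank_eq_one_of_selmerCorank_eq_one)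
    {n : ℕ} (hn : Squarefree n) {p : ℕ} [Fact p.Prime] (hp : 5 ≤ p) (hpn : ¬ p ∣ n)
    (hrank : (congruentNumberCurve n).mordellWeilRank = 1)
    (hsha : Finite (AddCommGroup.primaryComponent (congruentNumberCurve n).sha p)) :
    (congruentNumberCurve n).analyticRank = 1 := by
  have hpP : p.Prime := Fact.out
  have hodd : p % 2 = 1 := by
    rcases hpP.eq_two_or_odd with h | h
    · omega
    · exact h
  rcases (by omega : p % 4 = 1 ∨ p % 4 = 3) with h1 | h3
  · exact analyticRank_eq_one_of_rank_eq_one_of_finite_sha_primary_ordinary hBT hn hp h1 hpn hrank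
      hsha
  · exact CongruentShaFreeCutRungSupersingular.stub_rung_supersingular hBKO hn hp h3 hpn hrank hsha

end Summit.BirchSwinnertonDyer.BirchSwinnertonDyer.Theorems.CongruentShaFreeCutGoodPrimes
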